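import Summits.QuantumFields.YangMills.Theorems.LangevinControlUVOSLegsAtWeakCouplingCStubLowerITwoPoint
import Summits.QuantumFields.YangMills.Theorems.LangevinControlUVOSLegsAtWeakCouplingCStubLowerIThreePoint
import HarnessLib

/-!
# Stub `stub_lowerI` of line `inherited-amplitude-gates` (crux `OSLegsAtWeakCouplingC`, stmt-QuantumFields-16207)

Registered stub `stub_lowerI` of the skeleton `Cruxes/OSLegsAtWeakCouplingC/Lines/inherited_amplitude_gates.lean`
(lead `prover-line-stmt-QuantumFields-16207-a1-0`):

  `∀ G r a, (∀ β, 0 < a β) → a → 0 → FBL G r a → FC2I G r a → FC3 G r a → LowerBounds G r a`.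

The consumer of the INHERITED two-point package `FC2I`: the landed `stub_lower` of line `dlr-collar-transfer`
(`Theorems/LangevinControlUVOSLegsFromFemtoAndGapStubLower.lean`) re-run with `FC2I` in place of `FC2` — the two-point
half takes its scale, collar and floor from `FC2I`'s windowed clause (L) and reads a THIN bump
(`StubLowerI.lowerBoundsI_twoPoint`, `…StubLowerITwoPoint.lean`), the three-point half bounds the mixed terms of the law
of total cumulance by `FC2I`'s absolute clause (U) with its constant collar (`StubLowerI.lowerBoundsI_threePoint`,
`…StubLowerIThreePoint.lean`); FBL and FC3 enter exactly as before.
-/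

set_option autoImplicit false

noncomputable section

open scoped SchwartzMap BigOperators
open MeasureTheory Filter Topology
open Literature.MathematicalPhysics.QuantumFieldTheory Literature.MathematicalPhysics.QuantumLattice
open Literature.MathematicalPhysics.AQFT Literature.Probability.LatticeModels
open Summit.QuantumFields.YangMills.Cruxes.OSLegsFromFemtoAndGap.DlrCollarTransfer

namespace Summit.QuantumFields.YangMills.Cruxes.OSLegsAtWeakCouplingC.InheritedAmplitudeGates

/-- Registered stub `stub_lowerI` (**the consumer of the inherited package**): for a unit map `a > 0`, `a → 0`,
the femto boundary law `FBL`, the inherited conditional two-point package `FC2I` and the signed conditional cumulant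
floor `FC3` give the `k`-free lattice lower bounds `LowerBounds` — a positive-time bump `v` with `Q2(θv, v) ≥ ε > 0`
and three disjointly supported bumps with `|Q3(f, g, h)| ≥ ε` on every large torus at every large coupling. [folklore] -/
theorem stub_lowerI : ∀ (G : Type) [Group G] [TopologicalSpace G] [IsTopologicalGroup G] [CompactSpace G] [MeasurableSpace G] [BorelSpace G] (r : LatticeRep G) (a : ℝ → ℝ), (∀ β, 0 < a β) → Filter.Tendsto a Filter.atTop (nhds 0) → FBL G r a → FC2I G r a → FC3 G r a → LowerBounds G r a := by
  intro G _ _ _ _ _ _ r a hapos hlim hFBL hFC2I hFC3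
  exact ⟨StubLowerI.lowerBoundsI_twoPoint G r a hapos hlim hFBL hFC2I,
    StubLowerI.lowerBoundsI_threePoint G r a hapos hlim hFBL hFC2I hFC3⟩

end Summit.QuantumFields.YangMills.Cruxes.OSLegsAtWeakCouplingC.InheritedAmplitudeGates

end
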